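import Mathlib.Analysis.Calculus.Deriv.MeanValue
import Mathlib.Analysis.Calculus.Deriv.Pow
import Mathlib.Tactic.FieldSimp
import Mathlib.Tactic.Positivity
import HarnessLib

/-!
# A `C²` cutoff profile satisfying a one-sided second-order differential inequality

R. Bamler, *Entropy and heat kernel bounds on a Ricci flow background*, arXiv:2008.07093 (2020a),
§9, proof of Lemma 37 (arXiv numbering): the sub-solution `u = e^{-C₀ t} φ(d_t(x₀, ·))` of the
heat equation is built from a bump `φ : [0, ∞) → [0, 1]`, `φ ≡ 1` near `0`, `φ ≡ 0` far out, with
`φ' ≤ 0` and `A φ' + φ'' ≥ -C₀ φ`. Downstream (line `ancient-sphere-rigidity`) the bump is used in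
the squared-distance variable `q = d²`, `Φ(q) = φ(√q)`, where the required inequality reads
`-Φ'(q) (2m + 3Kq) - 4q Φ''(q) ≤ λ Φ(q)` for `q ≥ 0` (`m` = dimension, `K ≥ 0` a lower Ricci
bound, `λ ≥ 0` the exponential rate absorbed into `e^{-λt}`).

## The construction

`exists_cutoff_profile_ode` produces such a `Φ` of class `C²` (value, first and second derivative
as three functions `Φ, Φ', Φ''` with `HasDerivAt` everywhere), `Φ = 1` on `(-∞, q₁]`, `Φ = 0` on
`[q₂, ∞)`, `0 ≤ Φ ≤ 1`, `Φ' ≤ 0`. The profile is the quintic "smootherstep" complement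
`P(x) = 1 - 10x³ + 15x⁴ - 6x⁵ = (1 - x)³ (1 + 3x + 6x²)` in `x = (q - q₁)/(q₂ - q₁)`, clamped to
`[0, 1]`; `P'` and `P''` vanish at both ends, so clamping is `C²`. The point of the inequality:
where `Φ` is small (`x → 1`) the convexity term `4q Φ'' ∼ (1 - x)` dominates `|Φ'| ∼ (1 - x)²`
because `q ≥ q₁ > 0` there; on the rest `Φ ≥ δ³ > 0` and everything is bounded.

* `hasDerivAt_comp_clamp` — gluing lemma: `y ↦ g (max 0 (min 1 y))` is differentiable with
  derivative `g' ∘ clamp` as soon as `g' 0 = g' 1 = 0`;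
* `exists_clampedExtension`, `exists_smootherstep_profile` — the `C²` clamped profile;
* `smootherstep_ode_core` — the polynomial inequality behind the last clause;
* `exists_cutoff_profile_ode` — the statement consumed downstream.

Elementary real analysis; nothing about Ricci flow is in this file. No `Real.smoothTransition`
is needed (a `C²` profile suffices downstream).
-/

noncomputable section

open Set Filter

open scoped Topology

namespace Literature.Geometry.Riemannian

/-! ### Clamping a `C¹` function to `[0, 1]` -/

/-- **Gluing lemma.** If `g` has derivative `g'` everywhere and `g' 0 = g' 1 = 0`, then the clamped
function `y ↦ g (max 0 (min 1 y))` has derivative `g' (max 0 (min 1 y))` everywhere (the one-sided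
derivatives at the two corners agree). [folklore] -/
theorem hasDerivAt_comp_clamp {g g' : ℝ → ℝ} (hg : ∀ x, HasDerivAt g (g' x) x) (h0 : g' 0 = 0)
    (h1 : g' 1 = 0) (x : ℝ) :
    HasDerivAt (fun y ↦ g (max 0 (min 1 y))) (g' (max 0 (min 1 x))) x := by
  -- the clamp on the three closed pieces (cf. `clamp_of_le_zero` & co. in
  -- `Literature.Geometry.Symplectic.JHolomorphicCuspDoublePointsDesign`, not imported here)
  have c0 : ∀ {y : ℝ}, y ≤ 0 → max 0 (min 1 y) = 0 := fun hy ↦ by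
    rw [min_eq_right (hy.trans zero_le_one), max_eq_left hy]
  have c1 : ∀ {y : ℝ}, 1 ≤ y → max 0 (min 1 y) = 1 := fun hy ↦ by
    rw [min_eq_left hy, max_eq_right zero_le_one]
  have c2 : ∀ {y : ℝ}, y ∈ Icc (0 : ℝ) 1 → max 0 (min 1 y) = y := fun hy ↦ by
    rw [min_eq_right hy.2, max_eq_right hy.1]
  -- one-sided derivatives on the three closed pieces
  have hA : ∀ z, z ≤ 0 →
      HasDerivWithinAt (fun y ↦ g (max 0 (min 1 y))) (g' (max 0 (min 1 z))) (Iic 0) z := by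
    intro z hz
    rw [c0 hz, h0]
    exact (hasDerivWithinAt_const z (Iic 0) (g 0)).congr
      (fun y hy ↦ by simp only [c0 (mem_Iic.1 hy)]) (by simp only [c0 hz])
  have hB : ∀ z, 0 ≤ z → z ≤ 1 →
      HasDerivWithinAt (fun y ↦ g (max 0 (min 1 y))) (g' (max 0 (min 1 z))) (Icc 0 1) z := by
    intro z hz0 hz1
    rw [c2 ⟨hz0, hz1⟩]
    exact (hg z).hasDerivWithinAt.congr (fun y hy ↦ by simp only [c2 hy])
      (by simp only [c2 ⟨hz0, hz1⟩])
  have hC : ∀ z, 1 ≤ z →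
      HasDerivWithinAt (fun y ↦ g (max 0 (min 1 y))) (g' (max 0 (min 1 z))) (Ici 1) z := by
    intro z hz
    rw [c1 hz, h1]
    exact (hasDerivWithinAt_const z (Ici 1) (g 1)).congr
      (fun y hy ↦ by simp only [c1 (mem_Ici.1 hy)]) (by simp only [c1 hz])
  rcases le_or_gt x 0 with hx0 | hx0
  · rcases eq_or_lt_of_le hx0 with rfl | hx0'
    · exact ((hA 0 le_rfl).union (hB 0 le_rfl zero_le_one)).hasDerivAt
        (by rw [Iic_union_Icc_eq_Iic zero_le_one]; exact Iic_mem_nhds one_pos)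
    · exact (hA x hx0).hasDerivAt (Iic_mem_nhds hx0')
  rcases lt_or_ge x 1 with hx1 | hx1
  · exact (hB x hx0.le hx1.le).hasDerivAt (Icc_mem_nhds hx0 hx1)
  rcases eq_or_lt_of_le hx1 with rfl | hx1'
  · exact ((hB 1 zero_le_one le_rfl).union (hC 1 le_rfl)).hasDerivAt
      (by rw [Icc_union_Ici_eq_Ici zero_le_one]; exact Ici_mem_nhds one_pos)
  · exact (hC x hx1).hasDerivAt (Ici_mem_nhds hx1')

/-- **`C²` clamped extension.** If `g` is `C²` in the sense `g' = g₁`, `g₁' = g₂` everywhere and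
`g₁`, `g₂` vanish at `0` and `1`, then there are `φ, φ₁, φ₂ : ℝ → ℝ` with `φ' = φ₁`, `φ₁' = φ₂`
everywhere, `(φ, φ₁, φ₂) = (g 0, 0, 0)` on `(-∞, 0]`, `= (g 1, 0, 0)` on `[1, ∞)` and `= (g, g₁, g₂)`
on `[0, 1]`. [folklore] -/
theorem exists_clampedExtension {g g₁ g₂ : ℝ → ℝ} (hg : ∀ x, HasDerivAt g (g₁ x) x)
    (hg₁ : ∀ x, HasDerivAt g₁ (g₂ x) x) (h₁0 : g₁ 0 = 0) (h₁1 : g₁ 1 = 0) (h₂0 : g₂ 0 = 0)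
    (h₂1 : g₂ 1 = 0) :
    ∃ φ φ₁ φ₂ : ℝ → ℝ, (∀ x, HasDerivAt φ (φ₁ x) x) ∧ (∀ x, HasDerivAt φ₁ (φ₂ x) x) ∧
      (∀ x, x ≤ 0 → φ x = g 0 ∧ φ₁ x = 0 ∧ φ₂ x = 0) ∧
      (∀ x, 1 ≤ x → φ x = g 1 ∧ φ₁ x = 0 ∧ φ₂ x = 0) ∧
      (∀ x, 0 ≤ x → x ≤ 1 → φ x = g x ∧ φ₁ x = g₁ x ∧ φ₂ x = g₂ x) := by
  refine ⟨fun y ↦ g (max 0 (min 1 y)), fun y ↦ g₁ (max 0 (min 1 y)),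
    fun y ↦ g₂ (max 0 (min 1 y)), hasDerivAt_comp_clamp hg h₁0 h₁1,
    hasDerivAt_comp_clamp hg₁ h₂0 h₂1, ?_, ?_, ?_⟩
  · intro x hx
    simp only [min_eq_right (hx.trans zero_le_one), max_eq_left hx, h₁0, h₂0, and_self]
  · intro x hx
    simp only [min_eq_left hx, max_eq_right (zero_le_one' ℝ), h₁1, h₂1, and_self]
  · intro x hx0 hx1
    simp only [min_eq_right hx1, max_eq_right hx0, and_self]

/-! ### The quintic profile `P(x) = 1 - 10x³ + 15x⁴ - 6x⁵` -/

/-- `P' = -30x² + 60x³ - 30x⁴ (= -30 x² (1 - x)²)`. [folklore] -/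
theorem hasDerivAt_smootherstep (x : ℝ) :
    HasDerivAt (fun x : ℝ ↦ 1 - 10 * x ^ 3 + 15 * x ^ 4 - 6 * x ^ 5)
      (-30 * x ^ 2 + 60 * x ^ 3 - 30 * x ^ 4) x := by
  have h3 : HasDerivAt (fun x : ℝ ↦ x ^ 3) (3 * x ^ 2) x := by simpa using hasDerivAt_pow 3 x
  have h4 : HasDerivAt (fun x : ℝ ↦ x ^ 4) (4 * x ^ 3) x := by simpa using hasDerivAt_pow 4 x
  have h5 : HasDerivAt (fun x : ℝ ↦ x ^ 5) (5 * x ^ 4) x := by simpa using hasDerivAt_pow 5 x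
  exact ((((hasDerivAt_const x (1 : ℝ)).sub (h3.const_mul 10)).add (h4.const_mul 15)).sub
    (h5.const_mul 6)).congr_deriv (by ring)

/-- `P'' = -60x + 180x² - 120x³ (= -60 x (1 - x) (1 - 2x))`. [folklore] -/
theorem hasDerivAt_smootherstep_deriv (x : ℝ) :
    HasDerivAt (fun x : ℝ ↦ -30 * x ^ 2 + 60 * x ^ 3 - 30 * x ^ 4)
      (-60 * x + 180 * x ^ 2 - 120 * x ^ 3) x := by
  have h2 : HasDerivAt (fun x : ℝ ↦ x ^ 2) (2 * x) x := by simpa using hasDerivAt_pow 2 x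
  have h3 : HasDerivAt (fun x : ℝ ↦ x ^ 3) (3 * x ^ 2) x := by simpa using hasDerivAt_pow 3 x
  have h4 : HasDerivAt (fun x : ℝ ↦ x ^ 4) (4 * x ^ 3) x := by simpa using hasDerivAt_pow 4 x
  exact (((h2.const_mul (-30)).add (h3.const_mul 60)).sub (h4.const_mul 30)).congr_deriv (by ring)

/-- **The `C²` profile.** A `C²` function `φ` on `ℝ` (with derivatives `φ₁`, `φ₂`), equal to `1` on
`(-∞, 0]`, to `0` on `[1, ∞)`, to the smootherstep complement `1 - 10x³ + 15x⁴ - 6x⁵` on `[0, 1]`,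
and non-increasing (`φ₁ ≤ 0`). [folklore] -/
theorem exists_smootherstep_profile :
    ∃ φ φ₁ φ₂ : ℝ → ℝ, (∀ x, HasDerivAt φ (φ₁ x) x) ∧ (∀ x, HasDerivAt φ₁ (φ₂ x) x) ∧
      (∀ x, x ≤ 0 → φ x = 1 ∧ φ₁ x = 0 ∧ φ₂ x = 0) ∧
      (∀ x, 1 ≤ x → φ x = 0 ∧ φ₁ x = 0 ∧ φ₂ x = 0) ∧
      (∀ x, 0 ≤ x → x ≤ 1 → φ x = 1 - 10 * x ^ 3 + 15 * x ^ 4 - 6 * x ^ 5 ∧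
        φ₁ x = -30 * x ^ 2 + 60 * x ^ 3 - 30 * x ^ 4 ∧
        φ₂ x = -60 * x + 180 * x ^ 2 - 120 * x ^ 3) ∧
      (∀ x, φ₁ x ≤ 0) := by
  obtain ⟨φ, φ₁, φ₂, hd, hd₁, hle, hge, hmid⟩ := exists_clampedExtension hasDerivAt_smootherstep
    hasDerivAt_smootherstep_deriv (by norm_num) (by norm_num) (by norm_num) (by norm_num)
  refine ⟨φ, φ₁, φ₂, hd, hd₁, fun x hx ↦ ?_, fun x hx ↦ ?_, hmid, fun x ↦ ?_⟩
  · have h := hle x hx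
    norm_num at h
    exact h
  · have h := hge x hx
    norm_num at h
    exact h
  · rcases le_or_gt x 0 with hx0 | hx0
    · rw [(hle x hx0).2.1]
    rcases le_or_gt 1 x with hx1 | hx1
    · rw [(hge x hx1).2.1]
    rw [(hmid x hx0.le hx1.le).2.1]
    have hsq : 0 ≤ (x * (1 - x)) ^ 2 := sq_nonneg _
    nlinarith [hsq]

/-! ### The polynomial inequality -/

/-- **Core inequality.** For `x ∈ [0, 1]`, `q ∈ [q₁, q₂]` with `q₁ > 0`, `0 ≤ B ≤ B_max`, and the
constants `δ₀ ≤ 1/4`, `δ₀ (B_max ℓ + 1) ≤ 4 q₁`, `λ ℓ² δ₀³ = 30 (B_max ℓ + 8 q₂)`: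
`-(P'(x)/ℓ) B - 4 q P''(x)/ℓ² ≤ λ P(x)`. Near `x = 1` the left side is `≤ 0` (convexity wins since
`q ≥ q₁ > 0`); elsewhere `P(x) ≥ (1 - x)³ ≥ δ₀³`. [folklore] -/
theorem smootherstep_ode_core {x q ℓ B Bm q₁ q₂ δ₀ lam : ℝ} (hx0 : 0 ≤ x) (hx1 : x ≤ 1)
    (hℓ : 0 < ℓ) (hq₁ : 0 < q₁) (hq₁q : q₁ ≤ q) (hq₂ : q ≤ q₂) (hB0 : 0 ≤ B) (hB : B ≤ Bm)
    (hδ₀ : 0 < δ₀) (hδ₁ : δ₀ ≤ 1 / 4) (hδ₂ : δ₀ * (Bm * ℓ + 1) ≤ 4 * q₁)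
    (hlam : lam * (ℓ ^ 2 * δ₀ ^ 3) = 30 * (Bm * ℓ + 8 * q₂)) (hlam0 : 0 ≤ lam) :
    -((-30 * x ^ 2 + 60 * x ^ 3 - 30 * x ^ 4) / ℓ) * B -
        4 * q * ((-60 * x + 180 * x ^ 2 - 120 * x ^ 3) / ℓ ^ 2) ≤
      lam * (1 - 10 * x ^ 3 + 15 * x ^ 4 - 6 * x ^ 5) := by
  obtain ⟨u, hu⟩ : ∃ u : ℝ, u = 1 - x := ⟨_, rfl⟩
  have hu0 : 0 ≤ u := by rw [hu]; linarith
  have hu1 : u ≤ 1 := by rw [hu]; linarith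
  have hq0 : 0 ≤ q := hq₁.le.trans hq₁q
  have hBm0 : 0 ≤ Bm := hB0.trans hB
  have hL : -((-30 * x ^ 2 + 60 * x ^ 3 - 30 * x ^ 4) / ℓ) * B -
        4 * q * ((-60 * x + 180 * x ^ 2 - 120 * x ^ 3) / ℓ ^ 2) =
      30 * (x * u) * ((x * u) * B * ℓ + 8 * q * (2 * u - 1)) / ℓ ^ 2 := by
    rw [hu]
    field_simp
    ring
  have hR : 1 - 10 * x ^ 3 + 15 * x ^ 4 - 6 * x ^ 5 = u ^ 3 * (1 + 3 * x + 6 * x ^ 2) := by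
    rw [hu]; ring
  rw [hL, hR, div_le_iff₀ (by positivity)]
  have hs0 : 0 ≤ x * u := mul_nonneg hx0 hu0
  have hs1 : x * u ≤ 1 := mul_le_one₀ hx1 hu0 hu1
  have hrhs0 : 0 ≤ lam * (u ^ 3 * (1 + 3 * x + 6 * x ^ 2)) * ℓ ^ 2 := by positivity
  by_cases hc : u ≤ 1 / 4 ∧ u * (Bm * ℓ) ≤ 4 * q₁
  · -- near `x = 1`: the bracket is nonpositive
    have h1 : x * u * B * ℓ ≤ u * (Bm * ℓ) := by
      have h : x * u * B ≤ u * Bm := by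
        calc x * u * B = x * (u * B) := mul_assoc _ _ _
          _ ≤ 1 * (u * Bm) :=
            mul_le_mul hx1 (mul_le_mul_of_nonneg_left hB hu0) (mul_nonneg hu0 hB0) zero_le_one
          _ = u * Bm := one_mul _
      calc x * u * B * ℓ ≤ u * Bm * ℓ := mul_le_mul_of_nonneg_right h hℓ.le
        _ = u * (Bm * ℓ) := mul_assoc _ _ _
    have h2 : 8 * q * (2 * u - 1) ≤ 8 * q * (-1 / 2) :=
      mul_le_mul_of_nonneg_left (by linarith [hc.1]) (by positivity)
    have hbr : x * u * B * ℓ + 8 * q * (2 * u - 1) ≤ 0 := by linarith [hc.2]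
    have hlhs : 30 * (x * u) * (x * u * B * ℓ + 8 * q * (2 * u - 1)) ≤ 0 :=
      mul_nonpos_of_nonneg_of_nonpos (by positivity) hbr
    exact hlhs.trans hrhs0
  · -- away from `x = 1`: `u ≥ δ₀`, the left side is bounded, `P ≥ δ₀³`
    have hδu : δ₀ ≤ u := by
      by_contra h
      push Not at h
      apply hc
      refine ⟨by linarith, ?_⟩
      have h' : u * (Bm * ℓ) ≤ δ₀ * (Bm * ℓ) := mul_le_mul_of_nonneg_right h.le (by positivity)
      have h'' : δ₀ * (Bm * ℓ + 1) = δ₀ * (Bm * ℓ) + δ₀ := by ring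
      linarith
    -- bound the left side
    have hE1 : x * u * (x * u * B * ℓ) ≤ Bm * ℓ := by
      have h : x * u * (x * u) * B ≤ 1 * Bm :=
        mul_le_mul (mul_le_one₀ hs1 hs0 hs1) hB hB0 zero_le_one
      calc x * u * (x * u * B * ℓ) = x * u * (x * u) * B * ℓ := by ring
        _ ≤ 1 * Bm * ℓ := mul_le_mul_of_nonneg_right h hℓ.le
        _ = Bm * ℓ := by ring
    have hE2 : x * u * (8 * q * (2 * u - 1)) ≤ 8 * q₂ := by
      have h : 8 * q * (2 * u - 1) ≤ 8 * q * 1 :=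
        mul_le_mul_of_nonneg_left (by linarith) (by positivity)
      calc x * u * (8 * q * (2 * u - 1)) ≤ x * u * (8 * q * 1) := mul_le_mul_of_nonneg_left h hs0
        _ ≤ 1 * (8 * q * 1) := mul_le_mul_of_nonneg_right hs1 (by positivity)
        _ = 8 * q := by ring
        _ ≤ 8 * q₂ := by linarith
    have hE : 30 * (x * u) * (x * u * B * ℓ + 8 * q * (2 * u - 1)) ≤ 30 * (Bm * ℓ + 8 * q₂) := by
      have h : 30 * (x * u) * (x * u * B * ℓ + 8 * q * (2 * u - 1)) =
          30 * (x * u * (x * u * B * ℓ) + x * u * (8 * q * (2 * u - 1))) := by ring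
      rw [h]
      linarith
    -- bound the right side from below
    have hP : δ₀ ^ 3 * 1 ≤ u ^ 3 * (1 + 3 * x + 6 * x ^ 2) := by
      refine mul_le_mul (pow_le_pow_left₀ hδ₀.le hδu 3) ?_ zero_le_one (pow_nonneg hu0 3)
      have h : 0 ≤ 3 * x + 6 * x ^ 2 := by positivity
      linarith
    have hRHS : 30 * (Bm * ℓ + 8 * q₂) ≤ lam * (u ^ 3 * (1 + 3 * x + 6 * x ^ 2)) * ℓ ^ 2 := by
      calc 30 * (Bm * ℓ + 8 * q₂) = lam * (δ₀ ^ 3 * 1) * ℓ ^ 2 := by rw [← hlam]; ring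
        _ ≤ lam * (u ^ 3 * (1 + 3 * x + 6 * x ^ 2)) * ℓ ^ 2 :=
          mul_le_mul_of_nonneg_right (mul_le_mul_of_nonneg_left hP hlam0) (by positivity)
    exact hE.trans hRHS

/-! ### The cutoff -/

/-- **A `C²` cutoff profile for Bamler's barrier sub-solution.** For `m ∈ ℕ`, `K ≥ 0` and
`0 < q₁ < q₂` there are `Φ, Φ', Φ'' : ℝ → ℝ` and `λ ≥ 0` with: `Φ' ` is the derivative of `Φ` and
`Φ''` that of `Φ'` everywhere; `Φ` is non-increasing, `Φ = 1` on `(-∞, q₁]`, `Φ = 0` on `[q₂, ∞)`,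
`0 ≤ Φ ≤ 1`, `Φ' ≤ 0`; and for all `q ≥ 0`,
`-Φ'(q) (2m + 3Kq) - 4q Φ''(q) ≤ λ Φ(q)`.
This is the bump `φ` ("`φ' ≤ 0`, `Aφ' + φ'' ≥ -C₀ φ`") of Bamler's proof, written in the variable
`q = d²`. [cite: Bamler2020Entropy, §9, proof of Lemma 37 (arXiv numbering)] -/
theorem exists_cutoff_profile_ode (m : ℕ) {K q₁ q₂ : ℝ} (hK : 0 ≤ K) (hq₁ : 0 < q₁)
    (h12 : q₁ < q₂) :
    ∃ (Φ Φ' Φ'' : ℝ → ℝ) (lam : ℝ), 0 ≤ lam ∧ Antitone Φ ∧ (∀ q, HasDerivAt Φ (Φ' q) q) ∧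
      (∀ q, HasDerivAt Φ' (Φ'' q) q) ∧ (∀ q, q ≤ q₁ → Φ q = 1) ∧ (∀ q, q₂ ≤ q → Φ q = 0) ∧
      (∀ q, 0 ≤ Φ q) ∧ (∀ q, Φ q ≤ 1) ∧ (∀ q, Φ' q ≤ 0) ∧
      ∀ q, 0 ≤ q → -Φ' q * (2 * (m : ℝ) + 3 * K * q) - 4 * q * Φ'' q ≤ lam * Φ q := by
  obtain ⟨φ, φ₁, φ₂, hd, hd₁, hle, hge, hmid, hφ₁⟩ := exists_smootherstep_profile
  -- constants
  obtain ⟨ℓ, hℓdef⟩ : ∃ ℓ : ℝ, ℓ = q₂ - q₁ := ⟨_, rfl⟩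
  have hℓ : 0 < ℓ := by rw [hℓdef]; exact sub_pos.2 h12
  have hq₂ : 0 < q₂ := hq₁.trans h12
  obtain ⟨Bm, hBm⟩ : ∃ Bm : ℝ, Bm = 2 * m + 3 * K * q₂ := ⟨_, rfl⟩
  have hBm0 : 0 ≤ Bm := by rw [hBm]; positivity
  obtain ⟨δ₀, hδ₀0, hδ₁, hδ₂⟩ : ∃ δ₀ : ℝ, 0 < δ₀ ∧ δ₀ ≤ 1 / 4 ∧ δ₀ * (Bm * ℓ + 1) ≤ 4 * q₁ := by
    have hpos : 0 < Bm * ℓ + 1 := by positivity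
    refine ⟨min (1 / 4) (4 * q₁ / (Bm * ℓ + 1)), lt_min (by norm_num) (by positivity),
      min_le_left _ _, ?_⟩
    calc min (1 / 4) (4 * q₁ / (Bm * ℓ + 1)) * (Bm * ℓ + 1)
        ≤ 4 * q₁ / (Bm * ℓ + 1) * (Bm * ℓ + 1) :=
          mul_le_mul_of_nonneg_right (min_le_right _ _) hpos.le
      _ = 4 * q₁ := div_mul_cancel₀ _ hpos.ne'
  obtain ⟨lam, hlam0, hlam1⟩ :
      ∃ lam : ℝ, 0 ≤ lam ∧ lam * (ℓ ^ 2 * δ₀ ^ 3) = 30 * (Bm * ℓ + 8 * q₂) :=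
    ⟨30 * (Bm * ℓ + 8 * q₂) / (ℓ ^ 2 * δ₀ ^ 3), by positivity, div_mul_cancel₀ _ (by positivity)⟩
  -- derivatives of the rescaled profile
  have hXd : ∀ q, HasDerivAt (fun q : ℝ ↦ (q - q₁) / ℓ) (1 / ℓ) q := fun q ↦
    ((hasDerivAt_id' q).sub_const q₁).div_const ℓ
  have hΦd : ∀ q, HasDerivAt (fun q ↦ φ ((q - q₁) / ℓ)) (φ₁ ((q - q₁) / ℓ) / ℓ) q := fun q ↦
    ((hd ((q - q₁) / ℓ)).comp q (hXd q)).congr_deriv (mul_one_div _ _)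
  have hΦ'd : ∀ q, HasDerivAt (fun q ↦ φ₁ ((q - q₁) / ℓ) / ℓ) (φ₂ ((q - q₁) / ℓ) / ℓ ^ 2) q :=
    fun q ↦ (((hd₁ ((q - q₁) / ℓ)).comp q (hXd q)).div_const ℓ).congr_deriv (by ring)
  -- shape
  have hΦ'neg : ∀ q, φ₁ ((q - q₁) / ℓ) / ℓ ≤ 0 := fun q ↦
    div_nonpos_of_nonpos_of_nonneg (hφ₁ _) hℓ.le
  have hanti : Antitone (fun q ↦ φ ((q - q₁) / ℓ)) := antitone_of_hasDerivAt_nonpos hΦd hΦ'neg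
  have hX0 : ∀ q, q ≤ q₁ → (q - q₁) / ℓ ≤ 0 := fun q hq ↦
    div_nonpos_of_nonpos_of_nonneg (sub_nonpos.2 hq) hℓ.le
  have hX1 : ∀ q, q₂ ≤ q → 1 ≤ (q - q₁) / ℓ := fun q hq ↦
    (le_div_iff₀ hℓ).2 (by linarith)
  have h1 : ∀ q, q ≤ q₁ → φ ((q - q₁) / ℓ) = 1 := fun q hq ↦ (hle _ (hX0 q hq)).1
  have h0 : ∀ q, q₂ ≤ q → φ ((q - q₁) / ℓ) = 0 := fun q hq ↦ (hge _ (hX1 q hq)).1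
  have hnn : ∀ q, 0 ≤ φ ((q - q₁) / ℓ) := fun q ↦ by
    rcases le_total q q₂ with h | h
    · calc (0 : ℝ) = φ ((q₂ - q₁) / ℓ) := (h0 q₂ le_rfl).symm
        _ ≤ φ ((q - q₁) / ℓ) := hanti h
    · exact (h0 q h).ge
  have hle1 : ∀ q, φ ((q - q₁) / ℓ) ≤ 1 := fun q ↦ by
    rcases le_total q q₁ with h | h
    · exact (h1 q h).le
    · calc φ ((q - q₁) / ℓ) ≤ φ ((q₁ - q₁) / ℓ) := hanti h
        _ = 1 := h1 q₁ le_rfl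
  -- the differential inequality
  have hode : ∀ q, 0 ≤ q →
      -(φ₁ ((q - q₁) / ℓ) / ℓ) * (2 * (m : ℝ) + 3 * K * q) -
          4 * q * (φ₂ ((q - q₁) / ℓ) / ℓ ^ 2) ≤ lam * φ ((q - q₁) / ℓ) := by
    intro q hq0
    rcases le_or_gt q q₁ with hq | hq
    · obtain ⟨e0, e1, e2⟩ := hle _ (hX0 q hq)
      have he : -(φ₁ ((q - q₁) / ℓ) / ℓ) * (2 * (m : ℝ) + 3 * K * q) -
          4 * q * (φ₂ ((q - q₁) / ℓ) / ℓ ^ 2) = 0 := by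
        rw [e1, e2]; ring
      rw [he, e0, mul_one]
      exact hlam0
    rcases le_or_gt q₂ q with hq' | hq'
    · obtain ⟨e0, e1, e2⟩ := hge _ (hX1 q hq')
      have he : -(φ₁ ((q - q₁) / ℓ) / ℓ) * (2 * (m : ℝ) + 3 * K * q) -
          4 * q * (φ₂ ((q - q₁) / ℓ) / ℓ ^ 2) = lam * φ ((q - q₁) / ℓ) := by
        rw [e0, e1, e2]; ring
      exact he.le
    have hx0 : 0 ≤ (q - q₁) / ℓ := div_nonneg (by linarith) hℓ.le
    have hx1 : (q - q₁) / ℓ ≤ 1 := (div_le_one hℓ).2 (by linarith)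
    obtain ⟨e0, e1, e2⟩ := hmid _ hx0 hx1
    rw [e0, e1, e2]
    have hB0 : 0 ≤ 2 * (m : ℝ) + 3 * K * q := by positivity
    have hB : 2 * (m : ℝ) + 3 * K * q ≤ Bm := by
      rw [hBm]
      have h : 3 * K * q ≤ 3 * K * q₂ := mul_le_mul_of_nonneg_left hq'.le (by positivity)
      linarith
    exact smootherstep_ode_core hx0 hx1 hℓ hq₁ hq.le hq'.le hB0 hB hδ₀0 hδ₁ hδ₂ hlam1 hlam0
  exact ⟨fun q ↦ φ ((q - q₁) / ℓ), fun q ↦ φ₁ ((q - q₁) / ℓ) / ℓ, fun q ↦ φ₂ ((q - q₁) / ℓ) / ℓ ^ 2,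
    lam, hlam0, hanti, hΦd, hΦ'd, h1, h0, hnn, hle1, hΦ'neg, hode⟩

end Literature.Geometry.Riemannian
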